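import Literature.AnabelianGeometry.SemiGraphs.PSCSeparatingCoveringsIrreducibleMultiNodalEdges
import Literature.AnabelianGeometry.SemiGraphs.PSCIrreducibleMultiNodalOrigin
import HarnessLib

/-!
# [CombGC] Prop. 1.2: rows F-2829 / F-2830 and ALL of Prop. 1.2 (i)(ii) at the origin of IRREDUCIBLE MULTI-NODAL data

Mochizuki, *A combinatorial version of the Grothendieck conjecture*, Tohoku Math. J. **59** (2007)
[CombGC], PROOF of Proposition 1.2, p. 9 (separating coverings) [cite: MochizukiCombGC2007, Prop 1.2 proof p.9]
and Prop. 1.2 (i)(ii) p. 8 [cite: MochizukiCombGC2007, Prop 1.2 pp.8-9]; abc-iut FACT-LIST rows F-2829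
`SeparatingCoverings` / F-2830 `SeparatingCoveringsHolds Ω` (abc-iut-w4-d081), F-0438
`CommensurableTerminalityHolds Ω`, F-0459 `OpenInterDeterminesComponentHolds Ω` — the universal closures
are refuted as typed; instance forms at genuine carriers are what is wanted.

PROOF-ONLY assembly (abc-iut-f-164 gen 5) at the ORIGIN of all data of IRREDUCIBLE `k`-NODAL shape with
`r ≥ 2` marked points and `g ≥ 1` (the stratum `Δ_irr` and its self-intersections; vertex group an
HNN-base, NOT a free factor of `π₁`):

* `irreducibleMultiNodalOrigin_prop12_rows` — F-2829 ∧ Prop. 1.2 (i) ∧ Prop. 1.2 (ii) datum-wise at every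
  such origin (gen 2's origin hypothesis of `PSCIrreducibleMultiNodalOrigin.lean` with `1 ≤ g`, `2 ≤ r`);
* `exists_irreducibleMultiNodalOrigin_prop12_holds_all` — for every nonempty set of primes `Σ` the origin
  of these data is INHABITED by a STURDY member (the one-nodal curve of arithmetic genus `3` with two
  marked points: `Γ_{3,2}`, `k = 1`, vertex genus `2`) and satisfies
  `SeparatingCoveringsHolds Ω ∧ CommensurableTerminalityHolds Ω ∧ OpenInterDeterminesComponentHolds Ω`
  (w5-d183's P12-L00 `commensurableTerminalityHolds_of_separating`,
  `openInterDeterminesComponentHolds_of_separating`).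

Together with `PSCTwoComponentAffineProp12All.lean` (two components, one node, both marked) and
`PSCSeparatingCoveringsThreeChainAll.lean` (three-component chain), Prop. 1.2 is now kernel-checked IN
FULL at the codimension-one boundary strata `Δ_h` (marked on both sides) AND `Δ_irr` (`r ≥ 2`).  A shape
instance is consistency evidence for the typed schemata, NOT the printed theorem for all pointed stable
curves; typed ≠ proved; nothing here takes a side on [IUTchIII] Cor. 3.12.
-/

noncomputable section

namespace Literature.AnabelianGeometry.SemiGraphs

open scoped Pointwise
open Literature.GroupTheory.CombinatorialGroupTheory
open Literature.GroupTheory.CombinatorialGroupTheory.PuncturedSurfaceGroup (cuspInertia)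
open SemiGraphOfAnabelioids (IsProSigmaCompletion)

namespace PSCDatum

/-- **F-2829 ∧ [CombGC] Prop. 1.2 (i) ∧ Prop. 1.2 (ii), datum-wise, at every origin whose data are of
irreducible `k`-nodal shape with `r ≥ 2`, `g ≥ 1`** (profinite `Π` in `Type`).
[cite: MochizukiCombGC2007, Prop 1.2 pp.8-9] -/
theorem irreducibleMultiNodalOrigin_prop12_rows (Ω : PSCOrigin.{0})
    (hΩ : ∀ ⦃Q : Type⦄ [Group Q] [TopologicalSpace Q] [IsTopologicalGroup Q] (G : PSCDatum Q),
      Ω.IsOfPSCType G → CompactSpace Q ∧ T2Space Q ∧ TotallyDisconnectedSpace Q ∧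
        ∃ (S : Set ℕ) (g r k : ℕ) (hk : k ≤ g) (ι : PuncturedSurfaceGroup g r →* Q)
          (e : G.graph.C ≃ Fin r) (v₀ : G.graph.V) (eN : G.graph.N ≃ Fin k),
          S.Nonempty ∧ (∀ p ∈ S, p.Prime) ∧ IsProSigmaCompletion S ι ∧ 1 ≤ g ∧ 2 ≤ r ∧
          (∀ c, G.cuspGp c =
            ((PuncturedSurfaceGroup.cuspInertia (g := g) (e c)).map ι).topologicalClosure) ∧
          (∀ w, w = v₀) ∧
          (∀ m, G.nodeGp m = ((Subgroup.zpowers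
            (PuncturedSurfaceGroup.b (r := r) (Fin.castLE hk (eN m)))).map ι).topologicalClosure) ∧
          G.vertGp v₀ = ((Subgroup.closure {x : PuncturedSurfaceGroup g r |
            (∃ m : Fin k, x = PuncturedSurfaceGroup.b (Fin.castLE hk m) ∨
              x = PuncturedSurfaceGroup.a (Fin.castLE hk m) * PuncturedSurfaceGroup.b (Fin.castLE hk m) *
                (PuncturedSurfaceGroup.a (Fin.castLE hk m))⁻¹) ∨
            (∃ i : Fin g, k ≤ (i : ℕ) ∧ (x = PuncturedSurfaceGroup.a i ∨ x = PuncturedSurfaceGroup.b i)) ∨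
            ∃ j : Fin r, x = PuncturedSurfaceGroup.c j}).map ι).topologicalClosure ∧
          G.genus v₀ = g - k) :
    ∀ ⦃Q : Type⦄ [Group Q] [TopologicalSpace Q] [IsTopologicalGroup Q] (G : PSCDatum Q),
      Ω.IsOfPSCType G → G.SeparatingCoverings ∧
        (G.VerticialOpenInterDeterminesVertex ∧ G.EdgeLikeOpenInterDeterminesEdge ∧
          G.UnrVerticialOpenInterDeterminesVertex) ∧
        (G.VerticialEdgeLikeCommensurablyTerminal ∧ G.UnrVerticialCommensurablyTerminal) := by
  intro Q _ _ _ G hG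
  obtain ⟨hc, -, hd, S, g, r, k, hk, ι, e, v₀, eN, hne, hprime, hι, hg, hr, hC, hV, hE, hV₀, hgen⟩ := hΩ G hG
  have hsep := G.separatingCoverings_of_irreducibleMultiNodal hne hprime ι hι hk hg hr e hC v₀ hV eN hE hV₀ hgen
  exact ⟨hsep, G.prop12_of_separating hsep⟩

/-- **Rows F-2830, F-0438 (both clauses) and F-0459 as printed, AT THE ORIGIN OF ALL IRREDUCIBLE
`k`-NODAL DATA with `r ≥ 2`, `g ≥ 1`, INHABITED by a sturdy member** (`Γ_{3,2}` cut along one loop: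
vertex genus `2`, one node, two cusps), for every nonempty set of primes `Σ`.
[cite: MochizukiCombGC2007, Prop 1.2 pp.8-9] -/
theorem exists_irreducibleMultiNodalOrigin_prop12_holds_all (Sigma : Set ℕ) (hne : Sigma.Nonempty)
    (hprime : ∀ p ∈ Sigma, p.Prime) :
    ∃ Ω : PSCOrigin.{0},
      (∃ (Q : ProfiniteGrp.{0}) (G : PSCDatum Q), Ω.IsOfPSCType G ∧ G.IsSturdy ∧ G.Sigma = Sigma ∧
        G.graph.i = 1 ∧ G.graph.n = 1 ∧ G.graph.r = 2) ∧
      SeparatingCoveringsHolds Ω ∧ CommensurableTerminalityHolds Ω ∧ OpenInterDeterminesComponentHolds Ω := by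
  classical
  let Ω : PSCOrigin.{0} :=
    ⟨fun {Q} _ _ G => ∃ (_ : IsTopologicalGroup Q), CompactSpace Q ∧ T2Space Q ∧ TotallyDisconnectedSpace Q ∧
      ∃ (S : Set ℕ) (g r k : ℕ) (hk : k ≤ g) (ι : PuncturedSurfaceGroup g r →* Q)
        (e : G.graph.C ≃ Fin r) (v₀ : G.graph.V) (eN : G.graph.N ≃ Fin k),
        S.Nonempty ∧ (∀ p ∈ S, p.Prime) ∧ IsProSigmaCompletion S ι ∧ 1 ≤ g ∧ 2 ≤ r ∧
        (∀ c, G.cuspGp c =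
          ((PuncturedSurfaceGroup.cuspInertia (g := g) (e c)).map ι).topologicalClosure) ∧
        (∀ w, w = v₀) ∧
        (∀ m, G.nodeGp m = ((Subgroup.zpowers
          (PuncturedSurfaceGroup.b (r := r) (Fin.castLE hk (eN m)))).map ι).topologicalClosure) ∧
        G.vertGp v₀ = ((Subgroup.closure {x : PuncturedSurfaceGroup g r |
          (∃ m : Fin k, x = PuncturedSurfaceGroup.b (Fin.castLE hk m) ∨
            x = PuncturedSurfaceGroup.a (Fin.castLE hk m) * PuncturedSurfaceGroup.b (Fin.castLE hk m) *
              (PuncturedSurfaceGroup.a (Fin.castLE hk m))⁻¹) ∨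
          (∃ i : Fin g, k ≤ (i : ℕ) ∧ (x = PuncturedSurfaceGroup.a i ∨ x = PuncturedSurfaceGroup.b i)) ∨
          ∃ j : Fin r, x = PuncturedSurfaceGroup.c j}).map ι).topologicalClosure ∧
        G.genus v₀ = g - k⟩
  have hsep : SeparatingCoveringsHolds Ω := by
    intro Q _ _ _ G hG
    obtain ⟨_, hc, ht, hd, S, g, r, k, hk, ι, e, v₀, eN, hSne, hSp, hι, hg, hr, hC, hV, hE, hV₀, hgen⟩ := hG
    haveI := hc
    haveI := hd
    exact G.separatingCoverings_of_irreducibleMultiNodal hSne hSp ι hι hk hg hr e hC v₀ hV eN hE hV₀ hgen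
  have hprof : ∀ ⦃Q : Type⦄ [Group Q] [TopologicalSpace Q] [IsTopologicalGroup Q] (G : PSCDatum Q),
      Ω.IsOfPSCType G → CompactSpace Q ∧ TotallyDisconnectedSpace Q := fun Q _ _ _ G hG => by
    obtain ⟨_, hc, -, hd, -⟩ := hG
    exact ⟨hc, hd⟩
  refine ⟨Ω, ?_, hsep, commensurableTerminalityHolds_of_separating Ω hsep hprof,
    openInterDeterminesComponentHolds_of_separating Ω hsep hprof⟩
  -- the sturdy member: `Γ_{3,2}`, one loop (`k = 1`), vertex genus `2`
  obtain ⟨Q, ι, G, e, v₀, eN, hι, hS, hi, hn, hr, hC, hV, hE, hV₀, hgen, -⟩ :=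
    exists_irreducibleMultiNodalDatum Sigma hne hprime 3 2 1 (by norm_num)
  refine ⟨Q, G, ?_, fun v => by rw [hV v, hgen], hS, hi, hn, hr⟩
  exact ⟨inferInstance, inferInstance, inferInstance, inferInstance, Sigma, 3, 2, 1, by norm_num, ι, e, v₀, eN,
    hne, hprime, hι, by norm_num, le_rfl, hC, hV, hE, hV₀, hgen⟩

end PSCDatum

end Literature.AnabelianGeometry.SemiGraphs

end
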